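import Summits.AtomisticToContinuum.HydrodynamicLimit.Theorems.AntiMazurCoboundariesCorrectorPressureDecayKiferEntropyBoundGibbs
import Summits.AtomisticToContinuum.HydrodynamicLimit.Theorems.AntiMazurCoboundariesCorrectorPressureDecayTangentTightnessClosed

/-!
# Entropy bound for tangent states, V-b: the affinity reduction for the GIBBS-REFERENCE forms (line `FirstLemma`, crux stmt-AtomisticToContinuum-14135)

Helper file of the registered stub `stub_tangentEntropyBoundUniform` of line `FirstLemma`, namespace
`Summit.AtomisticToContinuum.HydrodynamicLimit.Theorems.KiferCompactification`; companion of …KiferEntropyBoundGibbs.lean (lead c8).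

`tangentEntropyBoundLocalGibbs_of_uniformGibbs : TangentEntropyBoundUniformGibbs → TangentEntropyBoundLocalGibbs` (PROVED) — the
affinity reduction `stub_tangentEntropyBoundLocalOfUniform` (…KiferEntropyBoundAffinity.lean, p144527) verbatim, with the Gibbs data
`(z, IsHardSphereGibbs 1 z θ⁻¹ u₀ G, density G = σ³)` of the reference passed through unchanged, and with both Kallenberg facts taken
from their DISCHARGES in the tree (`stub_tangentTightness`, p144923; `laplaceFunctionalDeterminesLaw_holds`, p143534): pass to a
subsequence realising the `liminf`; take a uniform-weight tangent state `μ¹` and, if `∫φ < 1`, a tangent state `ν` of the weight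
`1 − φ`; `μ¹ = (∫φ) μ^φ + (1 − ∫φ) ν` by affinity of `tangentLaplace` in the weight and Laplace-functional uniqueness; the unit-weight
bound for `μ¹` and the lower half of affinity `(∫φ) h(μ^φ | G) ≤ h(μ¹ | G)` (`stub_specificRelEntropyMixture`) give the weighted bound.
Consequently `tangentEntropyLowDensity_of_uniformGibbs : Georgii1995_hardSphereCanonicalLocalLimit → TangentEntropyBoundUniformGibbs →
TangentEntropyLowDensity`: the entropy input of the line's assembly from Georgii's fact and the Gibbs-reference unit-weight bound alone.
-/

noncomputable section

open MeasureTheory ProbabilityTheory Set Filter Topology InformationTheory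
open scoped ENNReal NNReal

namespace Summit.AtomisticToContinuum.HydrodynamicLimit.Theorems.KiferCompactification

open Literature.MathematicalPhysics.KineticTheory (T3 V3 hsDiameter localGibbsLaw blowUpPoint blowUp
  Georgii1995_hardSphereCanonicalLocalLimit)
open Literature.MathematicalPhysics.KineticTheory.PointProcess (laplaceFunctional specificRelEntropy windowLaw density)
open Literature.Analysis.FluidPDE (HardSphereFlow Config IsHardSphereGibbs IsTranslationInvariant)
open Literature.Analysis.FunctionSpaces (PointConfig)

/-- **The affinity reduction, Gibbs-reference form**: the general weighted bound from the unit-weight bound (tightness of tangent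
families and Laplace-functional uniqueness being theorems of the tree), the Gibbs data of the reference passed through. -/
theorem tangentEntropyBoundLocalGibbs_of_uniformGibbs (hU : TangentEntropyBoundUniformGibbs) : TangentEntropyBoundLocalGibbs := by
  have hT : TangentTightness := stub_tangentTightness
  have hK2 := laplaceFunctionalDeterminesLaw_holds
  obtain ⟨σ₂, hσ₂, hU⟩ := hU
  refine ⟨σ₂, hσ₂, ?_⟩
  intro σ a θ u₀ κ hσ hσlt ha hθ hκ φ hφ hφ0 hφ1 hφi N Φ Q hfam ι μ hμ hμP hμT G hGP hGT z hz hG hGd hGloc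
  haveI : IsProbabilityMeasure (volume : Measure T3) := by rw [volume_pi]; infer_instance
  haveI hQP : ∀ k, IsProbabilityMeasure (Q k) := hfam.2.1
  -- the weight `t = ∫φ ∈ (0, 1]`
  set t : ℝ := ∫ x, φ x with ht
  have ht0 : 0 < t := hφi
  have hφint : Integrable φ (volume : Measure T3) :=
    hφ.integrable_of_hasCompactSupport (HasCompactSupport.of_compactSpace φ)
  have ht1 : t ≤ 1 := by
    have h := integral_mono hφint (integrable_const (1 : ℝ)) hφ1
    rwa [integral_const, probReal_univ, one_smul] at h
  -- the entropy sequence `u k ∈ [0, κ]`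
  set uu : ℕ → ℝ := fun k => ((N (ι k) + 1 : ℕ) : ℝ)⁻¹ *
      (InformationTheory.klDiv (Q (ι k))
        (localGibbsLaw σ (fun _ => a) (fun _ => u₀) (fun _ => θ) (N (ι k)) (Φ (ι k)))).toReal with huu
  have hu0 : ∀ k, 0 ≤ uu k := fun k => mul_nonneg (inv_nonneg.2 (Nat.cast_nonneg _)) ENNReal.toReal_nonneg
  have huκ : ∀ k, uu k ≤ κ := by
    intro k
    have hKL := hfam.2.2.1 (ι k)
    have h1 : (InformationTheory.klDiv (Q (ι k))
        (localGibbsLaw σ (fun _ => a) (fun _ => u₀) (fun _ => θ) (N (ι k)) (Φ (ι k)))).toReal ≤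
        κ * (N (ι k) + 1) := by
      have h := ENNReal.toReal_mono ENNReal.ofReal_ne_top hKL
      rwa [ENNReal.toReal_ofReal (by positivity)] at h
    have hn : (0 : ℝ) < ((N (ι k) + 1 : ℕ) : ℝ) := by positivity
    rw [huu]
    simp only
    rw [inv_mul_le_iff₀ hn]
    calc _ ≤ κ * (N (ι k) + 1) := h1
      _ = ((N (ι k) + 1 : ℕ) : ℝ) * κ := by push_cast; ring
  -- Step A: a subsequence realising the liminf
  obtain ⟨r₀, hr₀, hr₀lim⟩ := exists_strictMono_tendsto_liminf hu0 huκ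
  -- Step B/C: a uniform-weight tangent state along `ι ∘ r₀ ∘ ι₁`
  have hι : StrictMono ι := hμ.1
  have hfam₁ := isTangentFamily_reindex hfam (hι.comp hr₀)
  obtain ⟨ι₁, μ₁, hμ₁P, hμ₁T, hμ₁⟩ := hT σ a θ u₀ κ hσ ha hθ hκ (fun _ => (1 : ℝ)) continuous_const
    (fun _ => zero_le_one) (fun _ => le_rfl) (by rw [integral_const, probReal_univ, one_smul]; exact one_pos)
    _ _ _ hfam₁
  have hι₁ : StrictMono ι₁ := hμ₁.1
  -- Step E: the decomposition `L_{μ₁} = t L_μ + (1 - t) L_ν` along a further subsequence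
  have key : ∃ (s : ℕ → ℕ) (ν : Measure (PointConfig (V3 × V3))), StrictMono s ∧ IsProbabilityMeasure ν ∧
      (∀ f : V3 × V3 → ℝ, Continuous f → HasCompactSupport f → (∀ p, 0 ≤ f p) →
        Tendsto (fun k => tangentLaplace σ (fun _ => (1 : ℝ)) (N (ι (r₀ (s k)))) (Q (ι (r₀ (s k)))) f) atTop
          (𝓝 (laplaceFunctional μ₁ f))) ∧
      ∀ f : V3 × V3 → ℝ, Continuous f → HasCompactSupport f → (∀ p, 0 ≤ f p) →
        laplaceFunctional μ₁ f = t * laplaceFunctional μ f + (1 - t) * laplaceFunctional ν f := by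
    rcases lt_or_eq_of_le ht1 with htlt | hteq
    · -- `t < 1`: a tangent state of the complementary weight `1 - φ`
      set ψ : T3 → ℝ := fun x => 1 - φ x with hψ
      have hψc : Continuous ψ := continuous_const.sub hφ
      have hψ0 : ∀ x, 0 ≤ ψ x := fun x => sub_nonneg.2 (hφ1 x)
      have hψ1 : ∀ x, ψ x ≤ 1 := fun x => show 1 - φ x ≤ 1 by linarith [hφ0 x]
      have hψi : ∫ x, ψ x = 1 - t := by
        show ∫ x, (1 - φ x) = 1 - t
        rw [integral_sub (integrable_const 1) hφint, integral_const, probReal_univ, one_smul]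
      have hψpos : 0 < ∫ x, ψ x := by rw [hψi]; linarith
      have hfam₂ := isTangentFamily_reindex hfam₁ hι₁
      obtain ⟨ι₂, ν, hνP, -, hν⟩ := hT σ a θ u₀ κ hσ ha hθ hκ ψ hψc hψ0 hψ1 hψpos _ _ _ hfam₂
      refine ⟨fun k => ι₁ (ι₂ k), ν, hι₁.comp hν.1, hνP,
        fun f hf hfc hf0 => (hμ₁.2 f hf hfc hf0).comp hν.1.tendsto_atTop, ?_⟩
      intro f hf hfc hf0
      have hA : Tendsto (fun k => tangentLaplace σ (fun _ => (1 : ℝ)) (N (ι (r₀ (ι₁ (ι₂ k)))))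
          (Q (ι (r₀ (ι₁ (ι₂ k))))) f) atTop (𝓝 (laplaceFunctional μ₁ f)) :=
        (hμ₁.2 f hf hfc hf0).comp hν.1.tendsto_atTop
      have hB : Tendsto (fun k => tangentLaplace σ φ (N (ι (r₀ (ι₁ (ι₂ k))))) (Q (ι (r₀ (ι₁ (ι₂ k))))) f) atTop
          (𝓝 (laplaceFunctional μ f)) :=
        (hμ.2 f hf hfc hf0).comp ((hr₀.comp (hι₁.comp hν.1)).tendsto_atTop)
      have hC : Tendsto (fun k => tangentLaplace σ ψ (N (ι (r₀ (ι₁ (ι₂ k))))) (Q (ι (r₀ (ι₁ (ι₂ k))))) f) atTop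
          (𝓝 (laplaceFunctional ν f)) :=
        hν.2 f hf hfc hf0
      have hid : ∀ k, tangentLaplace σ (fun _ => (1 : ℝ)) (N (ι (r₀ (ι₁ (ι₂ k))))) (Q (ι (r₀ (ι₁ (ι₂ k))))) f =
          t * tangentLaplace σ φ (N (ι (r₀ (ι₁ (ι₂ k))))) (Q (ι (r₀ (ι₁ (ι₂ k))))) f +
            (1 - t) * tangentLaplace σ ψ (N (ι (r₀ (ι₁ (ι₂ k))))) (Q (ι (r₀ (ι₁ (ι₂ k))))) f := by
        intro k
        rw [tangentLaplace_one_eq_add hφ ht0.ne' _ _ hf.measurable hf0, ← hψi,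
          integral_mul_tangentLaplace hψpos.ne']
      have hlim : Tendsto (fun k => tangentLaplace σ (fun _ => (1 : ℝ)) (N (ι (r₀ (ι₁ (ι₂ k)))))
          (Q (ι (r₀ (ι₁ (ι₂ k))))) f) atTop (𝓝 (t * laplaceFunctional μ f + (1 - t) * laplaceFunctional ν f)) :=
        ((hB.const_mul t).add (hC.const_mul (1 - t))).congr fun k => (hid k).symm
      exact tendsto_nhds_unique hA hlim
    · -- `t = 1`: `μ₁ = μ`
      refine ⟨ι₁, μ₁, hι₁, hμ₁P, fun f hf hfc hf0 => hμ₁.2 f hf hfc hf0, ?_⟩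
      intro f hf hfc hf0
      have hA : Tendsto (fun k => tangentLaplace σ (fun _ => (1 : ℝ)) (N (ι (r₀ (ι₁ k)))) (Q (ι (r₀ (ι₁ k)))) f)
          atTop (𝓝 (laplaceFunctional μ₁ f)) := hμ₁.2 f hf hfc hf0
      have hB : Tendsto (fun k => tangentLaplace σ φ (N (ι (r₀ (ι₁ k)))) (Q (ι (r₀ (ι₁ k)))) f) atTop
          (𝓝 (laplaceFunctional μ f)) :=
        (hμ.2 f hf hfc hf0).comp ((hr₀.comp hι₁).tendsto_atTop)
      have hid : ∀ k, tangentLaplace σ (fun _ => (1 : ℝ)) (N (ι (r₀ (ι₁ k)))) (Q (ι (r₀ (ι₁ k)))) f =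
          tangentLaplace σ φ (N (ι (r₀ (ι₁ k)))) (Q (ι (r₀ (ι₁ k)))) f := by
        intro k
        obtain ⟨-, hI01⟩ := integrable_innerLaplace σ (N (ι (r₀ (ι₁ k)))) (Q (ι (r₀ (ι₁ k)))) hf.measurable hf0
        have hle : ∫ x, (1 - φ x) * ∫ z, Real.exp (-(∑ i, f (blowUpPoint (hsDiameter σ (N (ι (r₀ (ι₁ k))))) x (z i)))) ∂(Q (ι (r₀ (ι₁ k)))) ≤
            ∫ x, (1 - φ x) :=
          integral_mono_of_nonneg (ae_of_all _ fun x => mul_nonneg (sub_nonneg.2 (hφ1 x)) (hI01 x).1)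
            ((integrable_const 1).sub hφint)
            (ae_of_all _ fun x => mul_le_of_le_one_right (sub_nonneg.2 (hφ1 x)) (hI01 x).2)
        have hnn : 0 ≤ ∫ x, (1 - φ x) * ∫ z, Real.exp (-(∑ i, f (blowUpPoint (hsDiameter σ (N (ι (r₀ (ι₁ k))))) x (z i)))) ∂(Q (ι (r₀ (ι₁ k)))) :=
          integral_nonneg fun x => mul_nonneg (sub_nonneg.2 (hφ1 x)) (hI01 x).1
        have h0 : ∫ x, (1 - φ x) = 0 := by
          rw [integral_sub (integrable_const 1) hφint, integral_const, probReal_univ, one_smul, ← ht, hteq, sub_self]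
        have hz0 : ∫ x, (1 - φ x) * ∫ z, Real.exp (-(∑ i, f (blowUpPoint (hsDiameter σ (N (ι (r₀ (ι₁ k))))) x (z i)))) ∂(Q (ι (r₀ (ι₁ k)))) = 0 := by
          linarith
        rw [tangentLaplace_one_eq_add hφ ht0.ne' _ _ hf.measurable hf0, hz0, add_zero, ← ht, hteq, one_mul]
      have h1 : laplaceFunctional μ₁ f = laplaceFunctional μ f :=
        tendsto_nhds_unique hA (hB.congr fun k => (hid k).symm)
      rw [h1, hteq]
      ring
  obtain ⟨s, ν, hs, hνP, hμ₁s, hdec⟩ := key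
  -- identify `μ₁ = t μ + (1 - t) ν` by Laplace-functional uniqueness
  have hμ₁eq : μ₁ = t.toNNReal • μ + (1 - t).toNNReal • ν := by
    haveI := hμ₁P; haveI := hμP; haveI := hνP
    refine hK2 (V3 × V3) fun f hf hfc hf0 => ?_
    rw [hdec f hf hfc hf0, laplaceFunctional_smul_add μ ν _ _ hf.measurable hfc hf0, Real.coe_toNNReal _ ht0.le,
      Real.coe_toNNReal _ (sub_nonneg.2 ht1)]
  -- Step D: the uniform bound along `ι₃ = ι ∘ r₀ ∘ s`, WITH the Gibbs data of `G`
  have hι₃ : StrictMono fun k => ι (r₀ (s k)) := hι.comp (hr₀.comp hs)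
  have hstate : IsTangentState σ (fun _ => (1 : ℝ)) N Q (fun k => ι (r₀ (s k))) μ₁ := ⟨hι₃, hμ₁s⟩
  have hloc₃ : ∀ Λ : Set V3, MeasurableSet Λ → Bornology.IsBounded Λ → ∀ A : Set (PointConfig (V3 × V3)),
      MeasurableSet A →
      Tendsto (fun k => windowLaw Λ (((volume : Measure T3).prod (localGibbsLaw σ (fun _ => a) (fun _ => u₀)
        (fun _ => θ) (N (ι (r₀ (s k)))) (Φ (ι (r₀ (s k)))))).map
          (fun p => blowUp (hsDiameter σ (N (ι (r₀ (s k))))) p.1 p.2)) A) atTop (𝓝 (windowLaw Λ G A)) :=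
    fun Λ hΛ hΛb A hA => (hGloc Λ hΛ hΛb A hA).comp ((hr₀.comp hs).tendsto_atTop)
  have hbound := hU σ a θ u₀ κ hσ hσlt ha hθ hκ N Φ Q hfam (fun k => ι (r₀ (s k))) μ₁ hstate hμ₁P hμ₁T G hGP hGT
    z hz hG hGd hloc₃
  have hlim₃ : liminf (fun k => uu (r₀ (s k))) atTop = liminf uu atTop := (hr₀lim.comp hs.tendsto_atTop).liminf_eq
  have hbound' : specificRelEntropy μ₁ G ≤ ENNReal.ofReal (σ ^ 3 * liminf uu atTop) := by
    rw [← hlim₃]; exact hbound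
  -- Step F: affinity; Step G: divide by `t`
  haveI := hμP; haveI := hνP; haveI := hGP
  have haff := stub_specificRelEntropyMixture μ ν G ht0.le ht1
  rw [← hμ₁eq] at haff
  have hfin : specificRelEntropy μ G * ENNReal.ofReal t ≤ ENNReal.ofReal (σ ^ 3 * liminf uu atTop) := by
    rw [mul_comm]; exact haff.trans hbound'
  have htne : ENNReal.ofReal t ≠ 0 := (ENNReal.ofReal_pos.2 ht0).ne'
  have hdiv : specificRelEntropy μ G ≤ ENNReal.ofReal (σ ^ 3 * liminf uu atTop) / ENNReal.ofReal t :=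
    (ENNReal.le_div_iff_mul_le (Or.inl htne) (Or.inl ENNReal.ofReal_ne_top)).2 hfin
  refine hdiv.trans_eq ?_
  rw [← ENNReal.ofReal_div_of_pos ht0]
  congr 1
  rw [ht]
  field_simp

/-- **The entropy input of the assembly from Georgii's fact and the Gibbs-reference unit-weight bound alone.** -/
theorem tangentEntropyLowDensity_of_uniformGibbs (hE : Georgii1995_hardSphereCanonicalLocalLimit)
    (hU : TangentEntropyBoundUniformGibbs) : TangentEntropyLowDensity :=
  tangentEntropyLowDensity_of_localLimitGibbs hE (tangentEntropyBoundLocalGibbs_of_uniformGibbs hU)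

end Summit.AtomisticToContinuum.HydrodynamicLimit.Theorems.KiferCompactification

end
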